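import Literature.AlgebraicGeometry.Resolution.AlterationsSemiStable
import Literature.AlgebraicGeometry.Motives.CartierDivisor
import HarnessLib

/-!
# `WildQuotients.SummitReduction` (stmt-ResolutionOfSingularities-16324), line `FramePerfect`:
# stub `stub_pair_dimZero` (base case `dim X = 0` of de Jong's equivariant alteration of pairs)

Route `ResolutionOfSingularities/WildQuotients`, crux `SummitReduction`; registered stub of the line
skeleton `Cruxes/SummitReduction/Lines/FramePerfect.lean` (v5).

The line proves de Jong's EQUIVARIANT alteration theorem in pair format (a finite group `G` acting on
a projective integral `X` over a field `k`, a closed `Z ≠ X` ⟹ a regular projective `X₁` with a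
finite group `G₁ ↠ G` acting, an equivariant alteration `π₁ : X₁ ⟶ X` whose invariants are purely
inseparable over `K(X)^G`, and `π₁⁻¹ Z` inside a `G₁`-stable `G₁`-strict normal crossings divisor)
by induction on `dim X`. This file is the base case `dim X ≤ 0` (de Jong 1996, 4.3: "The case
`dim X = 0` is all right"): an integral `X` of dimension `0` is one point, hence regular, and a
proper closed subset `Z ⊊ X` is empty; so `(G₁, X₁, ρ₁, φ₁, π₁, D₁) := (G, X, ρ, id, 𝟙 X, ∅)`
answers. Same vocabulary and argument as the non-equivariant base case
`DeJong1996.conclusionGenericallyEtale_of_topologicalKrullDim_le_zero`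
(`Literature/AlgebraicGeometry/Resolution/AlterationsStrong.lean`).
-/

set_option linter.dupNamespace false

noncomputable section

open CategoryTheory CategoryTheory.Limits AlgebraicGeometry TopologicalSpace
open Literature.AlgebraicGeometry.Resolution
open Literature.AlgebraicGeometry.Motives (RatFn.functionFieldMap RatFn.functionFieldMap_comp)
open Literature.AlgebraicGeometry

namespace Summit.ResolutionOfSingularities.ResolutionOfSingularities.Theorems

/-- **de Jong 1996, 4.3, base of the induction ("The case `dim X = 0` is all right"), equivariant
pair format.** Let a finite group `G` act on a projective integral `X` over a field `k` with
`dim X ≤ 0`, and let `Z ≠ X`. Then the identity datum solves the equivariant alteration problem: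
`G₁ := G`, `X₁ := X`, `ρ₁ := ρ`, `φ₁ := id`, `π₁ := 𝟙 X` (an alteration, trivially equivariant,
the identity on function fields so every `ρ`-invariant `a` is its own `K(X)^G`-witness with exponent
`p ^ 0`), `X` is regular (an integral scheme of dimension `0` has only its generic point, whose local
ring is the function field, `Scheme.IsRegular.of_topologicalKrullDim_le_zero`), `X` stays projective
over `k`, and `Z = ∅` (every point is the generic point, and `Z` misses one), so the empty divisor
`D₁ := ∅` — a strict normal crossings divisor, `G`-stable, with the `G`-strictness clause vacuous
since an irreducible set is non-empty — contains `π₁⁻¹ Z = ∅`.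
[cite: DeJong1996, 4.3, p. 66] -/
theorem stub_pair_dimZero (k : Type) [Field k] (X : Scheme.{0}) [IsIntegral X]
    (f : X ⟶ Spec (.of k)) (hproj : Motives.IsProjectiveOver (Over.mk f))
    (G : Type) [Group G] [Finite G] (ρ : G →* Aut X) (Z : Set X) (hZne : Z ≠ Set.univ)
    (hdim : topologicalKrullDim X ≤ (0 : ℕ)) :
    ∃ (G₁ : Type) (_ : Group G₁) (_ : Finite G₁) (X₁ : Scheme.{0}) (_ : IsIntegral X₁)
      (ρ₁ : G₁ →* Aut X₁) (φ₁ : G₁ →* G) (π₁ : X₁ ⟶ X) (_ : IsDominant π₁),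
      Function.Surjective φ₁ ∧ IsAlteration π₁ ∧ Scheme.IsRegular X₁ ∧
      Motives.IsProjectiveOver (Over.mk (π₁ ≫ f)) ∧
      (∀ g : G₁, (ρ₁ g).hom ≫ π₁ = π₁ ≫ (ρ (φ₁ g)).hom) ∧
      (∀ a : X₁.functionField, (∀ g : G₁, RatFn.functionFieldMap (ρ₁ g).hom a = a) →
        ∃ (n : ℕ) (c : X.functionField), (∀ g : G, RatFn.functionFieldMap (ρ g).hom c = c) ∧
          a ^ ringExpChar X.functionField ^ n = RatFn.functionFieldMap π₁ c) ∧
      ∃ D₁ : Set X₁, IsStrictNormalCrossingsDivisor X₁ D₁ ∧ π₁.base ⁻¹' (Z) ⊆ D₁ ∧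
        (∀ g : G₁, (ρ₁ g).hom.base '' D₁ = D₁) ∧
        (∀ (g : G₁) (C : Set X₁), Maximal (fun C : Set X₁ => IsIrreducible C ∧ C ⊆ D₁) C →
          (C ∩ (ρ₁ g).hom.base '' C).Nonempty → (ρ₁ g).hom.base '' C = C) := by
  have hdim' : topologicalKrullDim X ≤ 0 := by exact_mod_cast hdim
  -- `X` is one point (its generic point), so the proper subset `Z` is empty.
  have hZe : Z = ∅ := by
    obtain ⟨x, hx⟩ := (Set.ne_univ_iff_exists_notMem Z).mp hZne
    refine Set.eq_empty_iff_forall_notMem.mpr fun z hz => hx ?_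
    rwa [eq_genericPoint_of_topologicalKrullDim_le_zero hdim' x,
      ← eq_genericPoint_of_topologicalKrullDim_le_zero hdim' z]
  subst hZe
  refine ⟨G, inferInstance, inferInstance, X, inferInstance, ρ, MonoidHom.id G, 𝟙 X, inferInstance,
    fun g => ⟨g, rfl⟩, (isPurelyInseparableAlteration_id X).isAlteration,
    Scheme.IsRegular.of_topologicalKrullDim_le_zero hdim', ?_, ?_, ?_, ∅,
    IsStrictNormalCrossingsDivisor.empty X, ?_, ?_, ?_⟩
  · -- projectivity of `𝟙 X ≫ f = f`
    simpa only [Category.id_comp] using hproj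
  · -- equivariance of the identity
    intro g
    simp only [Category.comp_id, Category.id_comp, MonoidHom.id_apply]
  · -- invariants: `a` is its own witness, `a ^ (p ^ 0) = a = (𝟙 X)^♯ a`
    intro a ha
    refine ⟨0, a, ha, ?_⟩
    simp [Literature.AlgebraicGeometry.Motives.RatFn.functionFieldMap_id]
  · -- `π₁⁻¹ ∅ ⊆ ∅`
    simp
  · -- `∅` is `G`-stable
    intro g
    simp
  · -- strictness is vacuous: no irreducible set is contained in `∅`
    intro g C hC _
    exact absurd (Set.subset_empty_iff.mp hC.prop.2) hC.prop.1.nonempty.ne_empty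

end Summit.ResolutionOfSingularities.ResolutionOfSingularities.Theorems

end
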